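import Mathlib

/-!
# Route `BinomialElusive`, crux `PeelingLemma` (stmt-ValiantsHypothesis-7391) — vocabulary of the
negative lane "deterministic all-X designs", part 2: the THETA GADGET (route-posited object, D-0016)

Blueprint `Cruxes/PeelingLemma/DETERMINISTIC-ALLX.md` §1a/§3 (module [T]).  Companion of
`BinomialElusivePeelingLemmaWindowDefs.lean` (`win`, girth vocabulary); lemmas in
`BinomialElusivePeelingLemmaGadget.lean` (injective birth sequences, common branch vectors, privacy
of letters).  Nothing here asserts anything.
-/

-- `Summit.ValiantsHypothesis.ValiantsHypothesis.…` is the tree's mandated single-conjunct layout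
-- (Sub = Summit), so the duplicated namespace component is intended.
set_option linter.dupNamespace false
/-! ## Theta-gadget vocabulary (blueprint §1a/§3, module [T]; appended 2026-08-27 by val-width-7391-p1 g2)

One gadget `Θ₅(L′, q)` has, per alphabet, the letters `GLetter q no`: the `2q+1` letters `beta a` of
the branch vertex `b` (age `a` at `b`), the `2q+1` letters `beta' a` of `b'`, the ordinary births
`ord j k` of arm `j` (`k < no`), the extra closing letter `ex j` of arm `j`, and `junk` letters (never
alive at a gadget vertex; they only make the birth sequences globally injective).  Arm `j` is the
birth sequence `birth q no j : ℤ → GLetter q no`, read at positions `2q` (`= b`), …, `2q + L′`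
(`= b'`) with `L′ = no + 2q + 2`: births `beta` (in the arm's own age order, a transposition of the
ages `2q` and `2j` so that the five first-dropped letters differ), then `ord j 0, …, ord j (no-1)`,
then the closing births `ex j`, and the letters of `b'` except the kept letter `beta' (2j)`, which is
`birth q no j (2q + L′)`.  The vertex vector at position `t` is `PeelingLemmaWindow.win (birth q no j) q t`.
Nothing here asserts anything. -/

namespace Summit.ValiantsHypothesis.ValiantsHypothesis.Theorems.PeelingLemmaGadget

/-- Letters of one theta gadget with half-width `q` and `no` ordinary births per arm. -/
inductive GLetter (q no : ℕ) : Type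
  | beta (a : Fin (2 * q + 1))
  | beta' (a : Fin (2 * q + 1))
  | ord (j : Fin 5) (k : Fin no)
  | ex (j : Fin 5)
  | junk (z : ℤ)
  deriving DecidableEq

/-- The even age `min (2j) (2q)` attached to arm `j`: at `b` the ages `2q` and `evenAge q j` are
transposed (so the first letter dropped along arm `j` is `beta (evenAge q j)`), and at `b'` the kept
letter of arm `j` is `beta' (evenAge q j)`.  For `q ≥ 4` the five values are distinct. -/
def evenAge (q : ℕ) (j : Fin 5) : Fin (2 * q + 1) := ⟨min (2 * (j : ℕ)) (2 * q), by omega⟩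

/-- The top age `2q`. -/
def topAge (q : ℕ) : Fin (2 * q + 1) := ⟨2 * q, by omega⟩

/-- Arm `j`'s age order at `b`: the transposition of the ages `2q` and `evenAge q j`. -/
def armAge (q : ℕ) (j : Fin 5) : Equiv.Perm (Fin (2 * q + 1)) := Equiv.swap (topAge q) (evenAge q j)

/-- The even ages other than `evenAge q j`, enumerated by `k < q`: `2k` if `2k < evenAge`, else `2k+2`
(clamped to `2q`). -/
def skipAge (q : ℕ) (j : Fin 5) (k : ℕ) : Fin (2 * q + 1) :=
  ⟨min (if 2 * k < (evenAge q j : ℕ) then 2 * k else 2 * k + 2) (2 * q), by omega⟩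

/-- The closing birth number `i ∈ [1, 2q]` of arm `j` (born `i` steps after `ex j`): for even `i` the
minus letter `beta' (i-1)` of `b'`, for odd `i` the plus letter `beta' (skipAge q j ((i-1)/2))`. -/
def closing (q no : ℕ) (j : Fin 5) (i : ℕ) : GLetter q no :=
  if i % 2 = 0 then GLetter.beta' ⟨min (i - 1) (2 * q), by omega⟩
  else GLetter.beta' (skipAge q j ((i - 1) / 2))

/-- The birth sequence of arm `j` on natural positions: `beta` letters at `0..2q` (age `2q - n` at `b`,
permuted by `armAge`), ordinary births at `2q+1 .. 2q+no`, `ex j` at `2q+no+1`, closing births at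
`2q+no+2 .. 4q+no+1`, the kept letter `beta' (evenAge q j)` at `4q+no+2 = 2q + L′`, junk beyond. -/
def birthNat (q no : ℕ) (j : Fin 5) (n : ℕ) : GLetter q no :=
  if h₁ : n ≤ 2 * q then GLetter.beta (armAge q j ⟨2 * q - n, by omega⟩)
  else if h₂ : n ≤ 2 * q + no then GLetter.ord j ⟨n - (2 * q + 1), by omega⟩
  else if n = 2 * q + no + 1 then GLetter.ex j
  else if n ≤ 4 * q + no + 1 then closing q no j (n - (2 * q + no + 1))
  else if n = 4 * q + no + 2 then GLetter.beta' (evenAge q j)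
  else GLetter.junk n

/-- The birth sequence of arm `j` as a function on `ℤ` (junk at negative positions). -/
def birth (q no : ℕ) (j : Fin 5) (t : ℤ) : GLetter q no :=
  if t < 0 then GLetter.junk t else birthNat q no j t.toNat

end Summit.ValiantsHypothesis.ValiantsHypothesis.Theorems.PeelingLemmaGadget
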